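import Literature.Probability.RandomPlanarGeometry.JordanIndexOne
import Literature.Probability.RandomPlanarGeometry.TriangleDomain
import Literature.Probability.Percolation.TriApproxDomain
import HarnessLib

/-!
# Anticlockwise Carleson data have positively oriented boundary loops

Topic `Literature/Probability/Percolation`. Groundwork for the last named fact under Smirnov's
theorem, `tri_exists_discreteApprox` (`TriApproxDomain.lean`: Bollobás–Riordan, *Percolation*
(2006), Ch. 7, Lemma 14 p. 184 with (19), "for conformal rectangles with an *anticlockwise*
Carleson datum, `triangleTurn a b c = ω`"). The marked discrete domains of the tree
(`TriMarkedDomain`) traverse their boundary anticlockwise, so a discrete approximation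
`IsDiscreteApprox R G` (arc `i` of `G_δ` close to arc `i` of `R`, for all four `i`) can only exist
when the boundary loop of `R` is itself traversed anticlockwise; this file PROVES that the
Carleson hypothesis of the fact delivers exactly that:

* `index_eq_one_of_isCarlesonMap` — if `ψ : Ω → Δ(abc)` is a Carleson map of the conformal
  rectangle `R = (Ω; a', b', c', d')` onto a non-degenerate equilateral triangle
  (`IsCarlesonMap`: boundary values `a, b, c, d` at `a', b', c', d'`) and `abc` is anticlockwise
  (`triangleTurn a b c = triOmega = e^{2πi/3}`), then `R.index z = 1` for every `z ∈ Ω`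
  (`JordanDomain.index`, the winding number of the boundary loop, `JordanIndex.lean`).

Proof. By the Riemann mapping theorem and Carathéodory's theorem (both proved in the tree) there
are conformal maps `f : 𝔻 → Ω`, `g = ψ ∘ f : 𝔻 → Δ` with homeomorphic extensions `Φ`, `Ψ` to the
closed disc, whose boundary loops `Φ ∘ e`, `Ψ ∘ e` (`e(t) = e^{2πit}`) have index `1`
(`JordanIndexOne.lean`). The boundary loop of `R` is `(Φ ∘ e) ∘ σ` and the perimeter
`a → b → c → a` of `Δ` is `(Ψ ∘ e) ∘ τ` for circle homeomorphisms `σ`, `τ` of degree `±1`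
(`JordanDomain.exists_lift`), and `R.index = deg σ`, `Δ.index = deg τ`
(`JordanDomain.index_eq_mul_index`). The perimeter of an anticlockwise equilateral triangle has
index `1` (`index_triangleDomain_eq_one`, an explicit logarithm about the centre), so `τ` is
increasing; the boundary values of `ψ` give `Ψ (e (σ mₖ)) = a, b, c` at the marks
`m₀ < m₁ < m₂` of `a', b', c'` (`extension_apply_eq_of_hasBoundaryValue`), so `σ m₀, σ m₁, σ m₂`
are congruent modulo `ℤ` to the increasing parameters `τ 0 < τ (1/3) < τ (2/3) < τ 0 + 1`; were
`σ` decreasing, the integer shifts could not match. Hence `deg σ = 1`.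

## References

* B. Bollobás, O. Riordan, *Percolation*, Cambridge University Press (2006), Ch. 7, Lemma 14
  p. 184, §7.2.2 pp. 168–169 (anticlockwise conventions), p. 196 (Carleson's map `φ`).
* Ch. Pommerenke, *Boundary Behaviour of Conformal Maps* (1992), Thm. 2.6.

## Mathlib / tree

Mathlib: `AffineBasis.interior_convexHull`, `AffineBasis.coord_apply_combination_of_mem`,
`Complex.log_exp`, `Continuous.clog`, `Continuous.if_le`, `tendsto_nhds_unique`. Tree:
`JordanIndexOne.lean` (`exists_lift`, `index_eq_mul_index`, `exists_ofDiscMap`,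
`index_eq_one_of_boundary_eq`, `exists_int_of_boundary_eq`), `JordanIndex.lean` (`index`),
`TriangleDomain.lean` (`triangleDomain`, `triangleLoop`, `affineIndependent_of_dist_eq`),
`SmirnovConformalProofs.lean` via `TriApproxDomain.lean` (`sub_eq_triangleTurn_mul`,
`triangleTurn_sq_add_self_add_one`, `triangleTurn_pow_three`), `SmirnovTheorem.lean`
(`IsCarlesonMap`, `IsEquilateral`, `openTriangle`), `ConformalMapRiemannProofs.lean`,
`ConformalMapCaratheodoryProofs.lean`, `WindingNumber.lean` (`wind_spec`).
-/

noncomputable section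

open Set Filter Topology Metric Complex

namespace Literature.Probability.Percolation

open LatticeModels Literature.Probability.RandomPlanarGeometry
open Literature.Probability.RandomPlanarGeometry.JordanDomain

/-! ### The perimeter of an anticlockwise equilateral triangle winds once about its centre -/

section Triangle

variable {a b c : ℂ}

/-- `triOmega = ζ² = e^{2πi/3}`. [folklore] -/
theorem triOmega_eq_exp : triOmega = Complex.exp (((2 * Real.pi / 3 : ℝ) : ℂ) * Complex.I) := by
  rw [triOmega_eq, LatticeModels.triZeta, ← Complex.exp_nat_mul]
  congr 1; push_cast; ring

/-- The centre `(a + b + c)/3` lies in the open triangle. [folklore] -/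
theorem centroid_mem_triangleDomain (h : AffineIndependent ℝ ![a, b, c]) :
    (a + b + c) / 3 ∈ (triangleDomain a b c h).carrier := by
  rw [triangleDomain_carrier, ← range_triangleBasis h, (triangleBasis a b c h).interior_convexHull]
  set β := triangleBasis a b c h with hβ
  set w : Fin 3 → ℝ := fun _ => 1 / 3 with hw
  have hw1 : ∑ i, w i = 1 := by simp [hw]
  have hx : Finset.univ.affineCombination ℝ β w = (a + b + c) / 3 := by
    rw [Finset.affineCombination_eq_linear_combination _ _ _ hw1, Fin.sum_univ_three]
    simp only [hw, hβ, triangleBasis_apply_zero, triangleBasis_apply_one, triangleBasis_apply_two,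
      Complex.real_smul]
    push_cast; ring
  intro i
  rw [← hx, β.coord_apply_combination_of_mem (Finset.mem_univ i) hw1, hw]
  norm_num

/-- **The perimeter loop `a → b → c → a` of a non-degenerate equilateral triangle with
anticlockwise turn `(c - b)/(b - a) = e^{2πi/3}` has index `1` about the points of the open
triangle** (an explicit logarithm about the centre `w₀`: `b - w₀ = ω (a - w₀)`, and along each side
`(1 - s) + s ω` stays in the slit plane, its principal logarithm running from `0` to `2πi/3`).
[folklore] -/
theorem index_triangleDomain_eq_one (habc : IsEquilateral a b c) (hω : triangleTurn a b c = triOmega)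
    (h : AffineIndependent ℝ ![a, b, c]) {w : ℂ} (hw : w ∈ (triangleDomain a b c h).carrier) :
    (triangleDomain a b c h).index w = 1 := by
  set T := triangleDomain a b c h with hT
  set w₀ : ℂ := (a + b + c) / 3 with hw₀
  have hw₀T : w₀ ∈ T.carrier := centroid_mem_triangleDomain h
  rw [T.index_eq_of_mem_carrier hw hw₀T]
  -- algebra of the anticlockwise equilateral triangle
  set ω := triangleTurn a b c with hωdef
  have h1 : c - b = ω * (b - a) := sub_eq_triangleTurn_mul habc.2.2
  have h2 : ω ^ 2 + ω + 1 = 0 := triangleTurn_sq_add_self_add_one habc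
  have h3 : ω ^ 3 = 1 := triangleTurn_pow_three habc
  have hb : b - w₀ = ω * (a - w₀) := by
    rw [hw₀]; linear_combination ((ω - 1) / 3) * h1 + ((b - a) / 3) * h2
  have hc : c - w₀ = ω * (b - w₀) := by linear_combination h1 + hb
  have ha : a - w₀ = ω * (c - w₀) := by
    linear_combination (-ω) * hc + (-ω ^ 2) * hb + (-(a - w₀)) * h3
  have ha0 : a - w₀ ≠ 0 := by
    intro h0
    apply habc.2.2
    have hb0 : b - w₀ = 0 := by rw [hb, h0, mul_zero]
    rw [sub_eq_zero] at h0 hb0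
    rw [h0, hb0]
  -- `ω = e^{iθ}`, `θ = 2π/3`
  set θ : ℝ := 2 * Real.pi / 3 with hθ
  have hθpos : 0 < θ := by rw [hθ]; positivity
  have hθlt : θ < Real.pi := by rw [hθ]; linarith [Real.pi_pos]
  have hωexp : ω = Complex.exp ((θ : ℂ) * Complex.I) := by rw [hω, triOmega_eq_exp]
  have hθim : ((θ : ℂ) * Complex.I).im = θ := by simp
  have hωim : 0 < ω.im := by
    rw [hωexp, Complex.exp_im, hθim]
    have : ((θ : ℂ) * Complex.I).re = 0 := by simp
    rw [this, Real.exp_zero, one_mul]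
    exact Real.sin_pos_of_pos_of_lt_pi hθpos hθlt
  have hlogω : Complex.log ω = θ * Complex.I := by
    rw [hωexp]
    exact Complex.log_exp (by rw [hθim]; linarith [Real.pi_pos]) (by rw [hθim]; exact hθlt.le)
  -- the factor along a side stays in the slit plane
  set g : ℝ → ℂ := fun s => 1 + (s : ℂ) * (ω - 1) with hg
  have hgmem : ∀ s : ℝ, g s ∈ Complex.slitPlane := by
    intro s
    rw [Complex.mem_slitPlane_iff]
    by_cases hs : s = 0
    · left; simp [hg, hs]
    · right
      have : (g s).im = s * ω.im := by simp [hg]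
      rw [this]
      exact mul_ne_zero hs hωim.ne'
  have hgne : ∀ s : ℝ, g s ≠ 0 := fun s => Complex.slitPlane_ne_zero (hgmem s)
  have hgc : Continuous fun s : ℝ => Complex.log (g s) := by
    have : Continuous g := by rw [hg]; fun_prop
    exact this.clog hgmem
  have hg0 : Complex.log (g 0) = 0 := by simp [hg]
  have hg1' : g 1 = ω := by simp [hg]
  have hg1 : Complex.log (g 1) = θ * Complex.I := by rw [hg1', hlogω]
  -- the explicit logarithm of the perimeter loop about `w₀`
  set L₀ := Complex.log (a - w₀) with hL₀
  have heL₀ : Complex.exp L₀ = a - w₀ := Complex.exp_log ha0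
  set l : ℝ → ℂ := fun t =>
    if t ≤ 1 / 3 then L₀ + Complex.log (g (3 * t))
    else if t ≤ 2 / 3 then L₀ + θ * Complex.I + Complex.log (g (3 * t - 1))
    else L₀ + θ * Complex.I + θ * Complex.I + Complex.log (g (3 * t - 2)) with hl
  have hlc : Continuous l := by
    rw [hl]
    refine Continuous.if_le ?_ ?_ continuous_id continuous_const ?_
    · exact continuous_const.add (hgc.comp (continuous_const.mul continuous_id))
    · refine Continuous.if_le ?_ ?_ continuous_id continuous_const ?_
      · exact continuous_const.add (hgc.comp ((continuous_const.mul continuous_id).sub continuous_const))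
      · exact continuous_const.add (hgc.comp ((continuous_const.mul continuous_id).sub continuous_const))
      · intro x hx
        simp only [hx]
        norm_num
        rw [hg1, hg0]; ring
    · intro x hx
      simp only [hx]
      norm_num
      rw [hg1, hg0, add_zero]
  have hle : ∀ t ∈ Icc (0 : ℝ) 1, Complex.exp (l t) = triangleLoopAux a b c t - w₀ := by
    intro t _
    simp only [hl, triangleLoopAux]
    by_cases ht1 : t ≤ 1 / 3
    · rw [if_pos ht1, if_pos ht1, Complex.exp_add, heL₀, Complex.exp_log (hgne _),
        AffineMap.lineMap_apply_module', Complex.real_smul, hg]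
      simp only
      linear_combination (-((3 * t : ℝ) : ℂ)) * hb
    · rw [if_neg ht1, if_neg ht1]
      by_cases ht2 : t ≤ 2 / 3
      · rw [if_pos ht2, if_pos ht2, Complex.exp_add, Complex.exp_add, heL₀, ← hωexp,
          Complex.exp_log (hgne _), AffineMap.lineMap_apply_module', Complex.real_smul, hg]
        simp only
        linear_combination (-(1 + ((3 * t - 1 : ℝ) : ℂ) * (ω - 1))) * hb + (-((3 * t - 1 : ℝ) : ℂ)) * hc
      · rw [if_neg ht2, if_neg ht2, Complex.exp_add, Complex.exp_add, Complex.exp_add, heL₀, ← hωexp,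
          Complex.exp_log (hgne _), AffineMap.lineMap_apply_module', Complex.real_smul, hg]
        simp only
        linear_combination (-(1 + ((3 * t - 2 : ℝ) : ℂ) * (ω - 1))) * hc
          + (-ω * (1 + ((3 * t - 2 : ℝ) : ℂ) * (ω - 1))) * hb + (-((3 * t - 2 : ℝ) : ℂ)) * ha
  have h01 : triangleLoopAux a b c 0 - w₀ = triangleLoopAux a b c 1 - w₀ := by
    rw [triangleLoopAux_zero, triangleLoopAux_one]
  have hwind := Literature.Topology.PlaneTopology.wind_spec hlc.continuousOn hle h01
  have hl1 : l 1 - l 0 = (1 : ℤ) * (2 * Real.pi * Complex.I) := by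
    have e1 : ¬ ((1 : ℝ) ≤ 1 / 3) := by norm_num
    have e2 : ¬ ((1 : ℝ) ≤ 2 / 3) := by norm_num
    have e0 : (0 : ℝ) ≤ 1 / 3 := by norm_num
    simp only [hl, e1, e2, e0, if_false, if_true]
    norm_num
    rw [hg1, hg0, hθ]
    push_cast; ring
  -- the boundary loop of `T` agrees with `triangleLoopAux` on `[0, 1]`
  have hcongr : EqOn (fun t => T.boundary t - w₀) (fun t => triangleLoopAux a b c t - w₀) (Icc 0 1) := by
    intro t ht
    show triangleLoop a b c t - w₀ = triangleLoopAux a b c t - w₀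
    congr 1
    rcases ht.2.eq_or_lt with rfl | ht1
    · have hper : triangleLoop a b c 1 = triangleLoop a b c 0 := by
        simpa using periodic_triangleLoop a b c 0
      rw [triangleLoopAux_one, hper, triangleLoop_of_mem_Ico ⟨le_rfl, zero_lt_one⟩, triangleLoopAux_zero]
    · exact triangleLoop_of_mem_Ico ⟨ht.1, ht1⟩
  rw [JordanDomain.index, Literature.Topology.PlaneTopology.wind_congr hcongr]
  exact (Literature.Topology.PlaneTopology.int_eq_of_mul_two_pi_I_eq (hl1.symm.trans hwind)).symm

end Triangle

/-! ### Anticlockwise Carleson data have positively oriented boundary loops -/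

section Carleson

variable {a b c d : ℂ}

/-- Boundary values pass to the Carathéodory extensions: if `Φ` extends `f : 𝔻 → Ω` continuously
to the closed disc, `Ψ` extends `g = ψ ∘ f : 𝔻 → Δ` continuously to the closed disc, and `ψ` has
boundary value `p` at `Φ x ∈ ∂Ω` (`‖x‖ = 1`), then `Ψ x = p`. [folklore] -/
theorem extension_apply_eq_of_hasBoundaryValue {U V : Set ℂ} (f : ConformalEquiv (Metric.ball (0 : ℂ) 1) U)
    (ψ : ConformalEquiv U V) {Φ Ψ : ℂ → ℂ} (hΦc : ContinuousOn Φ (Metric.closedBall 0 1))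
    (hΦe : EqOn Φ f (Metric.ball 0 1)) (hΨc : ContinuousOn Ψ (Metric.closedBall 0 1))
    (hΨe : EqOn Ψ (f.trans ψ) (Metric.ball 0 1)) {x p : ℂ} (hx : x ∈ Metric.sphere (0 : ℂ) 1)
    (hbv : ψ.HasBoundaryValue (Φ x) p) : Ψ x = p := by
  have hxc : x ∈ Metric.closedBall (0 : ℂ) 1 := Metric.sphere_subset_closedBall hx
  haveI : (𝓝[Metric.ball (0 : ℂ) 1] x).NeBot := by
    rw [← mem_closure_iff_nhdsWithin_neBot, closure_ball (0 : ℂ) one_ne_zero]; exact hxc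
  -- `Φ → Φ x` within `U` along the ball
  have hΦt : Tendsto Φ (𝓝[Metric.ball 0 1] x) (𝓝[U] (Φ x)) :=
    ((hΦc x hxc).mono Metric.ball_subset_closedBall).tendsto_nhdsWithin fun y hy => by
      rw [hΦe hy]; exact f.mapsTo hy
  have h1 : Tendsto (ψ ∘ Φ) (𝓝[Metric.ball 0 1] x) (𝓝 p) := hbv.comp hΦt
  have h2 : Tendsto Ψ (𝓝[Metric.ball 0 1] x) (𝓝 p) := by
    refine h1.congr' ?_
    filter_upwards [self_mem_nhdsWithin] with y hy
    rw [hΨe hy, Function.comp_apply, ConformalEquiv.trans_apply, hΦe hy]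
  have h3 : Tendsto Ψ (𝓝[Metric.ball 0 1] x) (𝓝 (Ψ x)) :=
    ((hΨc x hxc).mono Metric.ball_subset_closedBall).tendsto
  exact tendsto_nhds_unique h3 h2

/-- **An anticlockwise Carleson datum forces the boundary loop to be positively oriented.** If the
conformal rectangle `R = (Ω; a', b', c', d')` carries a conformal equivalence `ψ : Ω → Δ(abc)` onto
a non-degenerate equilateral triangle with boundary values `a, b, c` at `a', b', c'` and the
triangle is anticlockwise (`(c - b)/(b - a) = e^{2πi/3}`), then `R.index z = 1` on `Ω`: the boundary
loop of `R` passes `a', b', c'` at increasing parameters, the perimeter of `Δ` passes `a, b, c`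
anticlockwise, and the Carathéodory extensions of `𝔻 → Ω` and `𝔻 → Δ` (loops of index `1`)
carry the same three points of the circle to `a', b', c'` and to `a, b, c`. This is the form in
which the hypothesis "marked points in anticlockwise order" of Bollobás–Riordan's Lemma 14
(Ch. 7 p. 184) enters `tri_exists_discreteApprox`. [cite: BollobasRiordan2006, Ch. 7 Lemma 14 p. 184] -/
theorem index_eq_one_of_isCarlesonMap (R : RandomPlanarGeometry.ConformalRectangle)
    (ψ : ConformalEquiv R.carrier (openTriangle a b c)) (habc : IsEquilateral a b c)
    (hψ : IsCarlesonMap R a b c d ψ) (hacw : triangleTurn a b c = triOmega) {z : ℂ}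
    (hz : z ∈ R.carrier) : R.index z = 1 := by
  -- a conformal map of the disc onto `Ω` and its Carathéodory extension
  obtain ⟨φ₀⟩ := exists_conformalEquiv_ball_holds (U := R.carrier) R.isOpen
    R.toJordanDomain.isSimplyConnected_carrier R.toJordanDomain.carrier_ne_univ
  set f : ConformalEquiv (Metric.ball (0 : ℂ) 1) R.carrier := φ₀.symm with hf
  obtain ⟨Φ, hΦc, hΦe, hΦbij, hΦbij'⟩ := exists_continuousOn_extension_holds R.toJordanDomain f
  obtain ⟨D₂, hD₂c, hD₂b⟩ := R.toJordanDomain.exists_ofDiscMap Φ hΦc hΦbij'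
  have hD₂i : D₂.index z = 1 :=
    index_eq_one_of_boundary_eq R.toJordanDomain D₂ f hΦc hΦe hΦbij.injOn hD₂c hD₂b hz
  obtain ⟨σ, hσc, hσ, hcase⟩ := exists_lift R.toJordanDomain D₂ hD₂c.symm
  have hzf : z ∉ frontier D₂.carrier := by
    rw [hD₂c]
    exact fun h' => (Set.disjoint_left.1 R.toJordanDomain.disjoint_carrier_frontier) hz h'
  -- the triangle, a conformal map of the disc onto it and its Carathéodory extension
  have haff : AffineIndependent ℝ ![a, b, c] := affineIndependent_of_dist_eq habc.1 habc.2.1 habc.2.2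
  set T : JordanDomain := triangleDomain a b c haff with hT
  set g : ConformalEquiv (Metric.ball (0 : ℂ) 1) T.carrier := f.trans ψ with hg
  obtain ⟨Ψ, hΨc, hΨe, hΨbij, hΨbij'⟩ := exists_continuousOn_extension_holds T g
  obtain ⟨T₂, hT₂c, hT₂b⟩ := T.exists_ofDiscMap Ψ hΨc hΨbij'
  have hg0 : g 0 ∈ T.carrier := g.mapsTo (Metric.mem_ball_self one_pos)
  have hT₂i : T₂.index (g 0) = 1 := index_eq_one_of_boundary_eq T T₂ g hΨc hΨe hΨbij.injOn hT₂c hT₂b hg0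
  have hTi : T.index (g 0) = 1 := index_triangleDomain_eq_one habc hacw haff hg0
  obtain ⟨τ, hτc, hτ, hcaseT⟩ := exists_lift T T₂ hT₂c.symm
  have hg0f : g 0 ∉ frontier T₂.carrier := by
    rw [hT₂c]
    exact fun h' => (Set.disjoint_left.1 T.disjoint_carrier_frontier) hg0 h'
  -- the lift on the triangle side is increasing
  obtain ⟨hτm, hτ1⟩ : StrictMonoOn τ (Icc 0 1) ∧ τ 1 = τ 0 + 1 := by
    rcases hcaseT with h' | ⟨-, h1⟩
    · exact h'
    · exfalso
      have := index_eq_mul_index T T₂ hτc hτ (n := -1) (by rw [h1]; simp [sub_eq_add_neg]) hg0f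
      rw [hTi, hT₂i] at this
      norm_num at this
  -- the three marked points on the circle
  have hm : ∀ k : Fin 4, R.mark k ∈ Ico (0 : ℝ) 1 := R.mark_mem
  have hm01 : R.mark 0 < R.mark 1 := R.strictMono_mark (by decide)
  have hm12 : R.mark 1 < R.mark 2 := R.strictMono_mark (by decide)
  have hIcc : ∀ k : Fin 4, R.mark k ∈ Icc (0 : ℝ) 1 := fun k => Ico_subset_Icc_self (hm k)
  have hΦu : ∀ k : Fin 4, Φ (Literature.Topology.PlaneTopology.circleLoop 0 1 (σ (R.mark k))) = R.pt k := by
    intro k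
    have := hσ (R.mark k) (hIcc k)
    rw [hD₂b] at this
    exact this
  have hsph : ∀ s : ℝ, Literature.Topology.PlaneTopology.circleLoop 0 1 s ∈ Metric.sphere (0 : ℂ) 1 :=
    fun s => Literature.Topology.PlaneTopology.circleLoop_mem_sphere 0 zero_le_one s
  have hΨu : ∀ (k : Fin 4) (p : ℂ), ψ.HasBoundaryValue (R.pt k) p →
      Ψ (Literature.Topology.PlaneTopology.circleLoop 0 1 (σ (R.mark k))) = p := by
    intro k p hbv
    refine extension_apply_eq_of_hasBoundaryValue f ψ hΦc hΦe hΨc hΨe (hsph _) ?_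
    rw [hΦu]; exact hbv
  have hΨa := hΨu 0 a hψ.1
  have hΨb := hΨu 1 b hψ.2.1
  have hΨc' := hΨu 2 c hψ.2.2.1
  -- the vertices along the perimeter loop of `T`
  have hTa : T₂.boundary (τ 0) = a := by
    rw [hτ 0 ⟨le_rfl, zero_le_one⟩]
    show triangleLoop a b c 0 = a
    rw [triangleLoop_of_mem_Ico ⟨le_rfl, zero_lt_one⟩, triangleLoopAux_zero]
  have hTb : T₂.boundary (τ (1 / 3)) = b := by
    rw [hτ (1 / 3) ⟨by norm_num, by norm_num⟩]
    show triangleLoop a b c (1 / 3) = b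
    rw [triangleLoop_of_mem_Ico ⟨by norm_num, by norm_num⟩, triangleLoopAux_one_third]
  have hTc : T₂.boundary (τ (2 / 3)) = c := by
    rw [hτ (2 / 3) ⟨by norm_num, by norm_num⟩]
    show triangleLoop a b c (2 / 3) = c
    rw [triangleLoop_of_mem_Ico ⟨by norm_num, by norm_num⟩, triangleLoopAux_two_thirds]
  -- hence the parameters agree modulo `ℤ`
  have hT₂bd : ∀ s, T₂.boundary s = Ψ (Literature.Topology.PlaneTopology.circleLoop 0 1 s) := fun s => by
    rw [hT₂b]
  obtain ⟨N₀, hN₀⟩ := T₂.exists_int_of_boundary_eq (s := σ (R.mark 0)) (t := τ 0) (by rw [hT₂bd, hΨa, hTa])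
  obtain ⟨N₁, hN₁⟩ := T₂.exists_int_of_boundary_eq (s := σ (R.mark 1)) (t := τ (1 / 3)) (by rw [hT₂bd, hΨb, hTb])
  obtain ⟨N₂, hN₂⟩ := T₂.exists_int_of_boundary_eq (s := σ (R.mark 2)) (t := τ (2 / 3)) (by rw [hT₂bd, hΨc', hTc])
  -- the perimeter passes `a, b, c` at increasing lifted parameters within one period
  have hτ01 : τ 0 < τ (1 / 3) := hτm ⟨le_rfl, zero_le_one⟩ ⟨by norm_num, by norm_num⟩ (by norm_num)
  have hτ12 : τ (1 / 3) < τ (2 / 3) := hτm ⟨by norm_num, by norm_num⟩ ⟨by norm_num, by norm_num⟩ (by norm_num)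
  have hτ2e : τ (2 / 3) < τ 0 + 1 := by
    rw [← hτ1]; exact hτm ⟨by norm_num, by norm_num⟩ ⟨zero_le_one, le_rfl⟩ (by norm_num)
  -- conclusion: the lift `σ` is increasing
  rcases hcase with ⟨-, h1⟩ | ⟨hanti, h1⟩
  · have := index_eq_mul_index R.toJordanDomain D₂ hσc hσ (n := 1) (by rw [h1]; simp) hzf
    rw [show R.index z = R.toJordanDomain.index z from rfl, this, hD₂i]; simp
  · exfalso
    -- along `σ` the marked parameters decrease within one period
    have hs01 : σ (R.mark 1) < σ (R.mark 0) := hanti (hIcc 0) (hIcc 1) hm01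
    have hs12 : σ (R.mark 2) < σ (R.mark 1) := hanti (hIcc 1) (hIcc 2) hm12
    have hs2e : σ (R.mark 0) - 1 < σ (R.mark 2) := by
      have h2 : σ 1 < σ (R.mark 2) := hanti (hIcc 2) ⟨zero_le_one, le_rfl⟩ (hm 2).2
      have h0 : σ (R.mark 0) ≤ σ 0 := hanti.antitoneOn ⟨le_rfl, zero_le_one⟩ (hIcc 0) (hm 0).1
      linarith
    -- compare the integer shifts
    have hd₁ : N₁ - N₀ = -1 := by
      have hlo : (-2 : ℝ) < ((N₁ - N₀ : ℤ) : ℝ) := by push_cast; linarith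
      have hhi : ((N₁ - N₀ : ℤ) : ℝ) < 0 := by push_cast; linarith
      have hlo' : (-2 : ℤ) < N₁ - N₀ := by exact_mod_cast hlo
      have hhi' : N₁ - N₀ < (0 : ℤ) := by exact_mod_cast hhi
      omega
    have hd₂ : N₂ - N₀ = -1 := by
      have hlo : (-2 : ℝ) < ((N₂ - N₀ : ℤ) : ℝ) := by push_cast; linarith
      have hhi : ((N₂ - N₀ : ℤ) : ℝ) < 0 := by push_cast; linarith
      have hlo' : (-2 : ℤ) < N₂ - N₀ := by exact_mod_cast hlo
      have hhi' : N₂ - N₀ < (0 : ℤ) := by exact_mod_cast hhi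
      omega
    have hd₁' : (N₁ : ℝ) = N₀ - 1 := by
      have : ((N₁ - N₀ : ℤ) : ℝ) = -1 := by exact_mod_cast hd₁
      push_cast at this; linarith
    have hd₂' : (N₂ : ℝ) = N₀ - 1 := by
      have : ((N₂ - N₀ : ℤ) : ℝ) = -1 := by exact_mod_cast hd₂
      push_cast at this; linarith
    rw [hd₁'] at hN₁
    rw [hd₂'] at hN₂
    linarith

end Carleson

end Literature.Probability.Percolation

end
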